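import Summits.Ventures.YMGap.RobustBall.LoopActionFiniteRange
import Summits.Ventures.YMGap.RobustBall.MassGapOnBallZdG
import HarnessLib

/-!
# Venture YMGap, track ROBUST-BALL (tier 1) — finite-range loop actions are members of the GAUGE-INVARIANT `ℤ^d` ball
# `MemBallZdG` (the ball of ds-2's robust vertex-star door)

HONEST FRAMING. WHAT THIS IS: a venture file (cell `pub-ymgap`, track Y2 ROBUST-BALL, seat rb-p1), the companion of
`LoopActionFiniteRange.lean` for ds-2's gauge-invariant tier-1 ball `MemBallZdG ε₀ ε₁ R W supp` (`MassGapOnBallZdG.lean`: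
`MemBallZd`-regularity + gauge invariance of every term + the SITE-incidence Lipschitz load). Loop actions are gauge invariant
term by term (`isZdGaugeInvariant_loopFamilyAction`), and the site load at `v` is at most the sum over the `d` links based at `v`
of the unweighted link norms, so: finite carrier fibres, finitely many loops per link, extent `≤ R` and `LoopNormLE 0 γ c ε` give
`(loopFamilyAction N γ c, loopSupp γ) ∈ MemBallZdG (2ε) (d·ε) R` (`memBallZdG_loopFamilyAction`); hence every row
`MassGapOnBallZdG d N β (2ε) (dε) R` (the star door's cells) yields `PerturbedMassGapAtS` for such loop actions
(`perturbedMassGapAtS_loopFamilyAction_of_gaugeBall`), in particular for all closed trails of length `≤ L₀` and for finite shape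
families. WHAT IT IS NOT: no door, no number; nothing about the continuum limit or the Clay problem.

References: ds-2 `MassGapOnBallZdG.lean`, `RobustStarDoorZd.lean`; this track's `LoopActionFiniteRange.lean`, `IndexedMemberFR.lean`.
-/

noncomputable section

open MeasureTheory Function Real SimpleGraph
open Literature.Probability.LatticeModels
open Literature.Probability.LatticeModels.DobrushinMetric
open Literature.MathematicalPhysics.QuantumLattice
open Literature.MathematicalPhysics.QuantumFieldTheory (walkEdges)

namespace Summit.Ventures.YMGap.RobustBall

variable {d N : ℕ} {ι : Type*}

/-! ### A finite-sum inequality -/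

/-- Indexed union bound for nonnegative sums: `∑_{x ∈ ⋃_a t a} f ≤ ∑_a ∑_{x ∈ t a} f`. -/
theorem sum_biUnion_le_of_nonneg {α κ : Type*} [DecidableEq α] (s : Finset κ) (t : κ → Finset α) {f : α → ℝ}
    (hf : ∀ x, 0 ≤ f x) : ∑ x ∈ s.biUnion t, f x ≤ ∑ a ∈ s, ∑ x ∈ t a, f x := by
  classical
  induction s using Finset.induction_on with
  | empty => simp
  | insert a s has ih =>
    rw [Finset.biUnion_insert, Finset.sum_insert has]
    -- union bound: `∑_{t a ∪ U} f ≤ ∑_{t a} f + ∑_U f` (the intersection sum is nonnegative)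
    have hu : ∑ x ∈ t a ∪ s.biUnion t, f x ≤ ∑ x ∈ t a, f x + ∑ x ∈ s.biUnion t, f x := by
      rw [← Finset.sum_union_inter]
      have h0 : 0 ≤ ∑ x ∈ t a ∩ s.biUnion t, f x := Finset.sum_nonneg fun x _ => hf x
      linarith
    exact hu.trans (add_le_add le_rfl ih)

/-! ### Membership in the gauge-invariant ball -/

section Member

variable {γ : ι → ZdLoop d} {c : ι → ℝ} {ε : ℝ} {R : ℕ}

/-- At weight `0`, through any of its links, the term `i` weighs exactly `|c_i| · |γ_i|`. -/
theorem loopWeightAt_zero_eq {e : ZdEdge d} {i : ι} (he : e ∈ walkEdges (γ i).walk) :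
    loopWeightAt 0 γ c e i = |c i| * ((γ i).walk.length : ℝ) := by
  unfold loopWeightAt
  rw [if_pos he]
  simp only [zero_mul, exp_zero, mul_one]
  rw [← Nat.cast_sum, sum_walkEdges_dartMult]

/-- **FINITE-RANGE LOOP ACTIONS ARE MEMBERS OF THE GAUGE-INVARIANT BALL**: finite carrier fibres, finitely many loops
through every link, loops of `ℓ^∞`-extent `≤ R`, and `‖c‖₀ ≤ ε` give
`(loopFamilyAction N γ c, loopSupp γ) ∈ MemBallZdG (2ε) (d·ε) R` (site-incidence Lipschitz load: the `d` links based at a site). -/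
theorem memBallZdG_loopFamilyAction (hfin : ∀ X, {i | walkEdges (γ i).walk = X}.Finite)
    (hthr : ∀ e : ZdEdge d, {i | e ∈ walkEdges (γ i).walk}.Finite)
    (hR : ∀ i, ∀ e ∈ walkEdges (γ i).walk, ∀ y ∈ walkEdges (γ i).walk, ‖e.1 - y.1‖ ≤ (R : ℝ))
    (h : LoopNormLE 0 γ c ε) :
    MemBallZdG (2 * ε) (d * ε) R (loopFamilyAction (d := d) N γ c) (loopSupp γ) := by
  haveI : DecidableEq ι := Classical.decEq ι
  have hB := memBallZd_loopFamilyAction (N := N) hfin hthr hR h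
  have hfib := mem_carrierFib hfin
  have hW0 := loopWeightAt_nonneg (0 : ℝ) γ c
  have hsumle : ∀ e : ZdEdge d, ∑ i ∈ throughFib (fun i => walkEdges (γ i).walk) e, loopWeightAt 0 γ c e i ≤ ε :=
    fun e => ((h.summable e).sum_le_tsum _ fun i _ => hW0 e i).trans (h.tsum_le e)
  -- oscillation load (as in the tier-1 member)
  have hoscL : ∀ e : ZdEdge d, ∑ X ∈ (loopSupp γ {e}).filter (fun X => e ∈ X),
      ∑ i ∈ carrierFib (fun i => walkEdges (γ i).walk) X, 2 * |c i| ≤ 2 * ε := by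
    intro e
    rw [sum_filter_indexedSupp_sum_fib_eq hfib hthr]
    have hle : ∀ i ∈ throughFib (fun i => walkEdges (γ i).walk) e, 2 * |c i| ≤ 2 * loopWeightAt 0 γ c e i :=
      fun i hi => mul_le_mul_of_nonneg_left (abs_coupling_le_loopWeightAt ((mem_throughFib hthr e i).1 hi)) (by norm_num)
    refine (Finset.sum_le_sum hle).trans ?_
    rw [← Finset.mul_sum]
    linarith [hsumle e]
  -- site-incidence Lipschitz load
  have hg0 : ∀ i, 0 ≤ |c i| * (((γ i).walk.length : ℝ) / Real.sqrt N) := fun i => by positivity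
  have hlink : ∀ e : ZdEdge d, ∑ i ∈ throughFib (fun i => walkEdges (γ i).walk) e,
      |c i| * (((γ i).walk.length : ℝ) / Real.sqrt N) ≤ ε := by
    intro e
    refine (Finset.sum_le_sum fun i hi => ?_).trans (hsumle e)
    have he := (mem_throughFib hthr e i).1 hi
    rw [loopWeightAt_zero_eq he, mul_div_assoc']
    calc |c i| * ((γ i).walk.length : ℝ) / Real.sqrt N = (Real.sqrt N)⁻¹ * (|c i| * ((γ i).walk.length : ℝ)) := by
          rw [div_eq_mul_inv]; ring
      _ ≤ 1 * (|c i| * ((γ i).walk.length : ℝ)) :=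
          mul_le_mul_of_nonneg_right (inv_sqrt_natCast_le_one N) (by positivity)
      _ = |c i| * ((γ i).walk.length : ℝ) := one_mul _
  have hsiteL : ∀ v : Site d, ∑ X ∈ listedAt (loopSupp γ) v,
      ∑ y ∈ X, ∑ i ∈ carrierFib (fun i => walkEdges (γ i).walk) X, |c i| * (dartMult (γ i).walk y / Real.sqrt N) ≤
        d * ε := by
    intro v
    -- per set: the double sum is the fibre sum of `|c_i| |γ_i| / √N`
    have hX : ∀ X ∈ listedAt (loopSupp γ) v,
        ∑ y ∈ X, ∑ i ∈ carrierFib (fun i => walkEdges (γ i).walk) X, |c i| * (dartMult (γ i).walk y / Real.sqrt N) =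
          ∑ i ∈ carrierFib (fun i => walkEdges (γ i).walk) X, |c i| * (((γ i).walk.length : ℝ) / Real.sqrt N) := by
      intro X _
      rw [Finset.sum_comm]
      refine Finset.sum_congr rfl fun i hi => ?_
      rw [← (hfib X i).1 hi, ← Finset.mul_sum, ← Finset.sum_div, ← Nat.cast_sum, sum_walkEdges_dartMult]
    rw [Finset.sum_congr rfl hX, sum_sum_fib_eq hfib]
    -- the union of the fibres over the listed sets sits inside the union of the terms through the `d` links at `v`
    have hsub : (listedAt (loopSupp γ) v).biUnion (carrierFib fun i => walkEdges (γ i).walk) ⊆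
        (Finset.univ : Finset (Fin d)).biUnion fun μ => throughFib (fun i => walkEdges (γ i).walk) ((v, μ) : ZdEdge d) := by
      intro i hi
      rw [Finset.mem_biUnion] at hi ⊢
      obtain ⟨X, hXl, hiX⟩ := hi
      obtain ⟨μ, hXs, hvX⟩ := mem_listedAt.1 hXl
      have hci : walkEdges (γ i).walk = X := (hfib X i).1 hiX
      exact ⟨μ, Finset.mem_univ μ, (mem_throughFib hthr _ i).2 (hci ▸ hvX)⟩
    calc ∑ i ∈ (listedAt (loopSupp γ) v).biUnion (carrierFib fun i => walkEdges (γ i).walk),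
          |c i| * (((γ i).walk.length : ℝ) / Real.sqrt N)
        ≤ ∑ i ∈ (Finset.univ : Finset (Fin d)).biUnion fun μ => throughFib (fun i => walkEdges (γ i).walk) ((v, μ) : ZdEdge d),
            |c i| * (((γ i).walk.length : ℝ) / Real.sqrt N) :=
          Finset.sum_le_sum_of_subset_of_nonneg hsub fun i _ _ => hg0 i
      _ ≤ ∑ μ : Fin d, ∑ i ∈ throughFib (fun i => walkEdges (γ i).walk) ((v, μ) : ZdEdge d),
            |c i| * (((γ i).walk.length : ℝ) / Real.sqrt N) := sum_biUnion_le_of_nonneg _ _ hg0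
      _ ≤ ∑ _μ : Fin d, ε := Finset.sum_le_sum fun μ _ => hlink _
      _ = d * ε := by rw [Finset.sum_const, Finset.card_univ, Fintype.card_fin, nsmul_eq_mul]
  exact ⟨hB.continuous, hB.dependsOn, hB.supportedBy, hB.range, fun X => isZdGaugeInvariant_loopFamilyAction γ c X,
    fun X y => ∑ i ∈ carrierFib (fun i => walkEdges (γ i).walk) X, 2 * |c i|,
    fun X y => ∑ i ∈ carrierFib (fun i => walkEdges (γ i).walk) X, |c i| * (dartMult (γ i).walk y / Real.sqrt N),
    fun X => isOscBound_indexedPotential (fun i => isOscBound_loopTerm (γ i).walk) X,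
    fun X => isLipBound_indexedPotential (fun i => isLipBound_loopTerm (γ i).walk) X, hoscL, hsiteL⟩

/-- **Mass gap for finite-range loop actions from a row on the gauge-invariant ball** (e.g. the robust vertex-star door's
cells): `MassGapOnBallZdG d N β (2ε) (dε) R` + the hypotheses of `memBallZdG_loopFamilyAction` ⇒ `PerturbedMassGapAtS`. -/
theorem perturbedMassGapAtS_loopFamilyAction_of_gaugeBall {β : ℝ} (hrow : MassGapOnBallZdG d N β (2 * ε) (d * ε) R)
    (hfin : ∀ X, {i | walkEdges (γ i).walk = X}.Finite) (hthr : ∀ e : ZdEdge d, {i | e ∈ walkEdges (γ i).walk}.Finite)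
    (hR : ∀ i, ∀ e ∈ walkEdges (γ i).walk, ∀ y ∈ walkEdges (γ i).walk, ‖e.1 - y.1‖ ≤ (R : ℝ)) (h : LoopNormLE 0 γ c ε) :
    PerturbedMassGapAtS d N β (loopFamilyAction (d := d) N γ c) :=
  (perturbedMassGapAtS_iff_of_supportedBy β (memBallZdG_loopFamilyAction hfin hthr hR h).supportedBy).2
    (hrow _ _ (memBallZdG_loopFamilyAction hfin hthr hR h))

end Member

/-! ### All closed trails of bounded length -/

section Bounded

variable {L₀ : ℕ} {c : TrailIdxLE d L₀ → ℝ} {ε : ℝ}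

/-- **All closed trails of length `≤ L₀` form a member of the gauge-invariant ball** `MemBallZdG (2ε) (dε) (2L₀)` as soon as
`‖c‖₀ ≤ ε`. -/
theorem memBallZdG_trailsLE (h : LoopNormLE 0 (trailLoopLE L₀) c ε) :
    MemBallZdG (2 * ε) (d * ε) (2 * L₀) (loopFamilyAction (d := d) N (trailLoopLE L₀) c) (loopSupp (trailLoopLE L₀)) :=
  memBallZdG_loopFamilyAction finite_fibre_trailLoopLE finite_through_trailLoopLE
    (fun i e he y hy => by exact_mod_cast norm_sub_le_trailLoopLE i e he y hy) h

/-- **Mass gap for all closed trails of length `≤ L₀` from a row on the gauge-invariant ball at range `2L₀`.** -/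
theorem perturbedMassGapAtS_trailsLE_of_gaugeBall {β : ℝ} (hrow : MassGapOnBallZdG d N β (2 * ε) (d * ε) (2 * L₀))
    (h : LoopNormLE 0 (trailLoopLE L₀) c ε) :
    PerturbedMassGapAtS d N β (loopFamilyAction (d := d) N (trailLoopLE L₀) c) :=
  (perturbedMassGapAtS_iff_of_supportedBy β (memBallZdG_trailsLE (N := N) h).supportedBy).2
    (hrow _ _ (memBallZdG_trailsLE h))

end Bounded

end Summit.Ventures.YMGap.RobustBall

end
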